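import Summits.BirchSwinnertonDyer.BirchSwinnertonDyer.Theorems.ErratumRoadFiveNonSurjCornerKolyJRedefinition
import HarnessLib

/-!
# Route `ErratumRoadFive` (rung K2), crux child `NonSurjCornerKolyJ` (item stmt-BirchSwinnertonDyer-19947), registered stub
# `stub_kolyJ_max` (and the 19111 Upper kit's `stub_upper3_jetchevMax`): the displays SHARPENED — «stub ⟸ {hswap, hlev}»,
# the finiteness input `hfin` (Gross–Zagier: `y_K` of infinite order) DROPPED
# (cell `bsd-stepL`, seat `bsd-stepL-corner-p1` g8; `--supports stmt-BirchSwinnertonDyer-19947`)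

WHAT. `…KolyJRedefinition` (p507157) re-keyed the max-form displays as «stub ⟸ {hfin, hswap, hlev}», `hfin` = «some admissible
`(n, d)` of the frame has `ord_p(P_n) < M(n)`» (at the J₃ frames: Gross–Zagier + `L(E^{d_K},1) ≠ 0`; but the (T4′)∕(T4″)
corner frames carry NO twist-value binder, so `hfin` is not available there uniformly in `K`). OBSERVATION: `hfin` is not
needed. If it FAILS — every admissible `(n, d)` has `ord_p(P_n) ≥ M(n)` — then the stub's conclusion `p^s ∣ P_n` for
`s ≤ M(n)` holds on the nose (`pDiv_of_le_divOrd`); if it HOLDS, `kolyvaginRedefinition_of_swap` + `pDiv_of_perLevel` apply.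
* §1 **`pDiv_of_swap_of_perLevel`** — frame-generic (any level `N`, prime `p`): `hswap → hlev → (s ≤ t → all indices ≥ s →
  p^s ∣ P_n)`, the case split above.
* §2 **`nonSurjCornerKolyJ_max_of_swap_of_perLevel'`** (= `stub_kolyJ_max` VERBATIM ⟸ hswap hlev),
  **`cornerUpper3_jetchevMax_of_swap_of_perLevel'`** (19111 Upper kit); the 19109 twin is
  `…EulerHalvesAtThreeJetchevMaxOfSwapSharp`.
So the corner max-form stubs now read «⟸ {swap supply, walk supply}» and nothing else. HONEST FRAMING: theorems only, no
definition ∕ fact ∕ sorry; hswap ∕ hlev are HYPOTHESES; no stub is discharged; nothing about any curve; T7.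
References: [McCallumLMS1991] §5 Lemma 5.1, Prop. 5.2; [BurungaleEtAl2026] Prop. 2.2.1; [Jetchev2008] Thm. 1.4, Proof of Thm. 1.1.
-/

set_option autoImplicit false

noncomputable section

open scoped Classical NumberField

namespace Summit.BirchSwinnertonDyer.Rank1Residual.X11b.Three.Koly

open WeierstrassCurve Literature.NumberTheory.EllipticCurves
  Literature.NumberTheory.EllipticCurves.ModularForms
  Literature.NumberTheory.EllipticCurves.Rank1Residual
  Summit.BirchSwinnertonDyer.Rank1Residual Summit.BirchSwinnertonDyer.Rank1Residual.X11b
  IsDedekindDomain NumberField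

universe u

/-! ### §1 The end bridge without the finiteness input -/

section Generic

variable {N : ℕ} [NeZero N] {W : WeierstrassCurve ℚ} {K : Type u} [Field K] [NumberField K]
  {Dt : ModularParametrizationData W N} {β : ℤ} {ι : K →+* ℂ} [W.IsGloballyMinimal]

/-- **`p^s ∣ P_n` from the swap supply and the per-level inequality ALONE** (frame-generic). If some admissible `(n, d)` has
`ord_p(P_n) < M(n)`, this is `kolyvaginRedefinition_of_swap` + `pDiv_of_perLevel`; otherwise every admissible derived point is
`p^{M(n)}`-divisible and the conclusion (`s ≤ M(n)`) is immediate. CONDITIONAL on hswap, hlev; nothing booked.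
[cite: McCallumLMS1991, §5 Prop. 5.2 (p. 304)] [cite: Jetchev2008, Thm. 1.4 (p. 812)] -/
theorem pDiv_of_swap_of_perLevel (p t : ℕ)
    (hswap : ∀ (M e : ℕ) (n : ℕ) (d : KolyvaginHeegnerData Dt β ι n), Squarefree n →
      (∀ ℓ ∈ n.primeFactors, Zhang2014.IsKolyvaginPrime N W K p ℓ ∧ M + 1 ≤ Zhang2014.kolyvaginIndex W p ℓ) →
      (∀ (n' : ℕ) (d' : KolyvaginHeegnerData Dt β ι n'), Squarefree n' →
        (∀ ℓ ∈ n'.primeFactors, Zhang2014.IsKolyvaginPrime N W K p ℓ ∧ M + 1 ≤ Zhang2014.kolyvaginIndex W p ℓ) →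
        PDiv d' p M) →
      ¬ PDiv d p (M + 1) →
      ∃ (n' : ℕ) (d' : KolyvaginHeegnerData Dt β ι n'), Squarefree n' ∧
        (∀ ℓ ∈ n'.primeFactors, Zhang2014.IsKolyvaginPrime N W K p ℓ ∧ e ≤ Zhang2014.kolyvaginIndex W p ℓ) ∧
        ¬ PDiv d' p (M + 1))
    (hlev : ∀ (k n : ℕ) (d : KolyvaginHeegnerData Dt β ι n), Squarefree n →
      (∀ ℓ ∈ n.primeFactors, Zhang2014.IsKolyvaginPrime N W K p ℓ) →
      (if divOrd d p < Zhang2014.levelIndex W p n then divOrd d p else (⊤ : ℕ∞)) < (k : ℕ∞) → t ≤ k →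
      (k : ℕ∞) + (if divOrd d p < Zhang2014.levelIndex W p n then divOrd d p else ⊤) ≤ Zhang2014.levelIndex W p n →
      (t : ℕ∞) ≤ (if divOrd d p < Zhang2014.levelIndex W p n then divOrd d p else ⊤))
    (s : ℕ) (hs : s ≤ t) (n : ℕ) (d : KolyvaginHeegnerData Dt β ι n) (hn : Squarefree n)
    (hℓ : ∀ ℓ ∈ n.primeFactors, Zhang2014.IsKolyvaginPrime N W K p ℓ ∧ s ≤ Zhang2014.kolyvaginIndex W p ℓ) :
    PDiv d p s := by
  by_cases hfin : ∃ (n' : ℕ) (d' : KolyvaginHeegnerData Dt β ι n'), Squarefree n' ∧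
      (∀ ℓ ∈ n'.primeFactors, Zhang2014.IsKolyvaginPrime N W K p ℓ) ∧ divOrd d' p < Zhang2014.levelIndex W p n'
  · obtain ⟨mInf, hmInf, hK⟩ := kolyvaginRedefinition_of_swap p hfin hswap
    exact pDiv_of_perLevel p t mInf
      (fun n d => if divOrd d p < Zhang2014.levelIndex W p n then divOrd d p else ⊤)
      (fun n d _ _ h => by simp [h]) hmInf hK hlev s hs n d hn hℓ
  · push Not at hfin
    apply pDiv_of_le_divOrd d p s
    calc (s : ℕ∞) ≤ Zhang2014.levelIndex W p n := natCast_le_levelIndex_of_forall fun ℓ h => (hℓ ℓ h).2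
      _ ≤ divOrd d p := hfin n d hn fun ℓ h => (hℓ ℓ h).1

end Generic

/-! ### §2 The corner displays, sharp -/

/-- **`stub_kolyJ_max` (19947 v2) ⟸ {hswap, hlev}** — no finiteness ∕ Gross–Zagier input. Frame binders VERBATIM those of
the registered stub. CONDITIONAL; nothing booked. [cite: Jetchev2008, Thm. 1.4 (p. 812)] [cite: McCallumLMS1991, §5 Prop. 5.2 (p. 304)]
[cite: BurungaleEtAl2026, Prop. 2.2.1 (§2.2)] -/
theorem nonSurjCornerKolyJ_max_of_swap_of_perLevel'
    (hswap : ∀ (W : WeierstrassCurve ℚ) [W.IsElliptic] [W.IsGloballyMinimal] [NeZero (W.conductorNorm ℤ)]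
      (p : ℕ) [Fact p.Prime] (K : Type) [Field K] [NumberField K]
      (Dt : ModularParametrizationData W (W.conductorNorm ℤ)) (β : ℤ) (ι : K →+* ℂ),
      p ∣ W.tamagawaProduct →
      ClassX11b W p → ¬ Surj W p → (p = 5 ∨ p = 7) → p ∣ padicValInt p W.minimalDiscriminantInt →
      ¬ Ram W p → IsImaginaryQuadratic K → 4 < (NumberField.discr K).natAbs →
      SatisfiesHeegnerHypothesis (W.conductorNorm ℤ) K → SatisfiesHeegnerHypothesis p K →
      (4 * (W.conductorNorm ℤ : ℤ)) ∣ β ^ 2 - NumberField.discr K → ¬ (p : ℤ) ∣ Dt.c →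
      ∀ (M e : ℕ) (n : ℕ) (d : KolyvaginHeegnerData Dt β ι n), Squarefree n →
        (∀ ℓ ∈ n.primeFactors, Zhang2014.IsKolyvaginPrime (W.conductorNorm ℤ) W K p ℓ ∧
          M + 1 ≤ Zhang2014.kolyvaginIndex W p ℓ) →
        (∀ (n' : ℕ) (d' : KolyvaginHeegnerData Dt β ι n'), Squarefree n' →
          (∀ ℓ ∈ n'.primeFactors, Zhang2014.IsKolyvaginPrime (W.conductorNorm ℤ) W K p ℓ ∧
            M + 1 ≤ Zhang2014.kolyvaginIndex W p ℓ) → PDiv d' p M) →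
        ¬ PDiv d p (M + 1) →
        ∃ (n' : ℕ) (d' : KolyvaginHeegnerData Dt β ι n'), Squarefree n' ∧
          (∀ ℓ ∈ n'.primeFactors, Zhang2014.IsKolyvaginPrime (W.conductorNorm ℤ) W K p ℓ ∧
            e ≤ Zhang2014.kolyvaginIndex W p ℓ) ∧ ¬ PDiv d' p (M + 1))
    (hlev : ∀ (W : WeierstrassCurve ℚ) [W.IsElliptic] [W.IsGloballyMinimal] [NeZero (W.conductorNorm ℤ)]
      (p : ℕ) [Fact p.Prime] (K : Type) [Field K] [NumberField K]
      (Dt : ModularParametrizationData W (W.conductorNorm ℤ)) (β : ℤ) (ι : K →+* ℂ),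
      p ∣ W.tamagawaProduct →
      ClassX11b W p → ¬ Surj W p → (p = 5 ∨ p = 7) → p ∣ padicValInt p W.minimalDiscriminantInt →
      ¬ Ram W p → IsImaginaryQuadratic K → 4 < (NumberField.discr K).natAbs →
      SatisfiesHeegnerHypothesis (W.conductorNorm ℤ) K → SatisfiesHeegnerHypothesis p K →
      (4 * (W.conductorNorm ℤ : ℤ)) ∣ β ^ 2 - NumberField.discr K → ¬ (p : ℤ) ∣ Dt.c →
      ∀ (v : HeightOneSpectrum (𝓞 ℚ)) (k n : ℕ) (d : KolyvaginHeegnerData Dt β ι n), Squarefree n →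
        (∀ ℓ ∈ n.primeFactors, Zhang2014.IsKolyvaginPrime (W.conductorNorm ℤ) W K p ℓ) →
        (if divOrd d p < Zhang2014.levelIndex W p n then divOrd d p else (⊤ : ℕ∞)) < (k : ℕ∞) →
        padicValNat p (W.tamagawaNumberAt v) ≤ k →
        (k : ℕ∞) + (if divOrd d p < Zhang2014.levelIndex W p n then divOrd d p else ⊤) ≤
          Zhang2014.levelIndex W p n →
        (padicValNat p (W.tamagawaNumberAt v) : ℕ∞) ≤
          (if divOrd d p < Zhang2014.levelIndex W p n then divOrd d p else ⊤)) :
    ∀ (W : WeierstrassCurve ℚ) [W.IsElliptic] [W.IsGloballyMinimal] [NeZero (W.conductorNorm ℤ)]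
      (p : ℕ) [Fact p.Prime] (K : Type) [Field K] [NumberField K]
      (Dt : ModularParametrizationData W (W.conductorNorm ℤ)) (β : ℤ) (ι : K →+* ℂ),
      p ∣ W.tamagawaProduct →
      ClassX11b W p → ¬ Surj W p → (p = 5 ∨ p = 7) → p ∣ padicValInt p W.minimalDiscriminantInt →
      ¬ Ram W p → IsImaginaryQuadratic K → 4 < (NumberField.discr K).natAbs →
      SatisfiesHeegnerHypothesis (W.conductorNorm ℤ) K → SatisfiesHeegnerHypothesis p K →
      (4 * (W.conductorNorm ℤ : ℤ)) ∣ β ^ 2 - NumberField.discr K → ¬ (p : ℤ) ∣ Dt.c →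
      ∀ (v : HeightOneSpectrum (𝓞 ℚ)) (s : ℕ), s ≤ padicValNat p (W.tamagawaNumberAt v) →
        ∀ (n : ℕ) (d : KolyvaginHeegnerData Dt β ι n), Squarefree n →
          (∀ ℓ ∈ n.primeFactors, Zhang2014.IsKolyvaginPrime (W.conductorNorm ℤ) W K p ℓ ∧
            s ≤ Zhang2014.kolyvaginIndex W p ℓ) → PDiv d p s := by
  intro W _ _ _ p _ K _ _ Dt β ι htam hX hns h57 hv hnr hK' hd hHN hHp hβ hc v s hs n d hn hℓ
  exact pDiv_of_swap_of_perLevel p (padicValNat p (W.tamagawaNumberAt v))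
    (hswap W p K Dt β ι htam hX hns h57 hv hnr hK' hd hHN hHp hβ hc)
    (fun k n d hn' hℓ' h1 h2 h3 => hlev W p K Dt β ι htam hX hns h57 hv hnr hK' hd hHN hHp hβ hc v k n d hn' hℓ' h1 h2 h3)
    s hs n d hn hℓ

/-- **`stub_upper3_jetchevMax` (19111 Upper kit) ⟸ {hswap, hlev}** — same at `p = 3`. CONDITIONAL; nothing booked.
[cite: Jetchev2008, Thm. 1.4 (p. 812)] [cite: McCallumLMS1991, §5 Prop. 5.2 (p. 304)] -/
theorem cornerUpper3_jetchevMax_of_swap_of_perLevel'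
    (hswap : ∀ (W : WeierstrassCurve ℚ) [W.IsElliptic] [W.IsGloballyMinimal] [NeZero (W.conductorNorm ℤ)]
      (K : Type) [Field K] [NumberField K]
      (Dt : ModularParametrizationData W (W.conductorNorm ℤ)) (β : ℤ) (ι : K →+* ℂ),
      ClassX11b W 3 → ¬ Surj W 3 →
      IsImaginaryQuadratic K → SatisfiesHeegnerHypothesis (W.conductorNorm ℤ) K →
      Odd (NumberField.discr K) →
      (4 * (W.conductorNorm ℤ : ℤ)) ∣ β ^ 2 - NumberField.discr K → ¬ (3 : ℤ) ∣ Dt.c →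
      ∀ (M e : ℕ) (n : ℕ) (d : KolyvaginHeegnerData Dt β ι n), Squarefree n →
        (∀ ℓ ∈ n.primeFactors, Zhang2014.IsKolyvaginPrime (W.conductorNorm ℤ) W K 3 ℓ ∧
          M + 1 ≤ Zhang2014.kolyvaginIndex W 3 ℓ) →
        (∀ (n' : ℕ) (d' : KolyvaginHeegnerData Dt β ι n'), Squarefree n' →
          (∀ ℓ ∈ n'.primeFactors, Zhang2014.IsKolyvaginPrime (W.conductorNorm ℤ) W K 3 ℓ ∧
            M + 1 ≤ Zhang2014.kolyvaginIndex W 3 ℓ) → PDiv d' 3 M) →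
        ¬ PDiv d 3 (M + 1) →
        ∃ (n' : ℕ) (d' : KolyvaginHeegnerData Dt β ι n'), Squarefree n' ∧
          (∀ ℓ ∈ n'.primeFactors, Zhang2014.IsKolyvaginPrime (W.conductorNorm ℤ) W K 3 ℓ ∧
            e ≤ Zhang2014.kolyvaginIndex W 3 ℓ) ∧ ¬ PDiv d' 3 (M + 1))
    (hlev : ∀ (W : WeierstrassCurve ℚ) [W.IsElliptic] [W.IsGloballyMinimal] [NeZero (W.conductorNorm ℤ)]
      (K : Type) [Field K] [NumberField K]
      (Dt : ModularParametrizationData W (W.conductorNorm ℤ)) (β : ℤ) (ι : K →+* ℂ),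
      ClassX11b W 3 → ¬ Surj W 3 →
      IsImaginaryQuadratic K → SatisfiesHeegnerHypothesis (W.conductorNorm ℤ) K →
      Odd (NumberField.discr K) →
      (4 * (W.conductorNorm ℤ : ℤ)) ∣ β ^ 2 - NumberField.discr K → ¬ (3 : ℤ) ∣ Dt.c →
      ∀ (v : HeightOneSpectrum (𝓞 ℚ)) (k n : ℕ) (d : KolyvaginHeegnerData Dt β ι n), Squarefree n →
        (∀ ℓ ∈ n.primeFactors, Zhang2014.IsKolyvaginPrime (W.conductorNorm ℤ) W K 3 ℓ) →
        (if divOrd d 3 < Zhang2014.levelIndex W 3 n then divOrd d 3 else (⊤ : ℕ∞)) < (k : ℕ∞) →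
        padicValNat 3 (W.tamagawaNumberAt v) ≤ k →
        (k : ℕ∞) + (if divOrd d 3 < Zhang2014.levelIndex W 3 n then divOrd d 3 else ⊤) ≤
          Zhang2014.levelIndex W 3 n →
        (padicValNat 3 (W.tamagawaNumberAt v) : ℕ∞) ≤
          (if divOrd d 3 < Zhang2014.levelIndex W 3 n then divOrd d 3 else ⊤)) :
    ∀ (W : WeierstrassCurve ℚ) [W.IsElliptic] [W.IsGloballyMinimal] [NeZero (W.conductorNorm ℤ)]
      (K : Type) [Field K] [NumberField K]
      (Dt : ModularParametrizationData W (W.conductorNorm ℤ)) (β : ℤ) (ι : K →+* ℂ),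
      ClassX11b W 3 → ¬ Surj W 3 →
      IsImaginaryQuadratic K → SatisfiesHeegnerHypothesis (W.conductorNorm ℤ) K →
      Odd (NumberField.discr K) →
      (4 * (W.conductorNorm ℤ : ℤ)) ∣ β ^ 2 - NumberField.discr K → ¬ (3 : ℤ) ∣ Dt.c →
      ∀ (v : HeightOneSpectrum (𝓞 ℚ)) (s : ℕ), s ≤ padicValNat 3 (W.tamagawaNumberAt v) →
        ∀ (n : ℕ) (d : KolyvaginHeegnerData Dt β ι n), Squarefree n →
          (∀ ℓ ∈ n.primeFactors, Zhang2014.IsKolyvaginPrime (W.conductorNorm ℤ) W K 3 ℓ ∧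
            s ≤ Zhang2014.kolyvaginIndex W 3 ℓ) → PDiv d 3 s := by
  intro W _ _ _ K _ _ Dt β ι hX hns hK' hHN hodd hβ hc v s hs n d hn hℓ
  exact pDiv_of_swap_of_perLevel 3 (padicValNat 3 (W.tamagawaNumberAt v))
    (hswap W K Dt β ι hX hns hK' hHN hodd hβ hc)
    (fun k n d hn' hℓ' h1 h2 h3 => hlev W K Dt β ι hX hns hK' hHN hodd hβ hc v k n d hn' hℓ' h1 h2 h3)
    s hs n d hn hℓ

end Summit.BirchSwinnertonDyer.Rank1Residual.X11b.Three.Koly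

end
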